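import Summits.ResolutionOfSingularities.ResolutionOfSingularities.Theorems.EquisingularLiftEquisingularLiftNatCompleteIntersectionLift
import Literature.AlgebraicGeometry.Motives.ProjClosedFractions
import HarnessLib

/-!
# [OURS · L1 W4.5(b) · EL♮(3)] «SATURATED LIFT ⇒ LIFTABLE CENTRE» — the class-free Proj half of the nose rungs

Cell `res-hironaka`, LADDER-RESOLUTION rung L (D-0089), slot W4.5(b); crux **EL♮(3)** `EquisingularLiftNatThree`
(stmt-ResolutionOfSingularities-20148) / parent EL♮ (stmt-20038); residue `stub_elnat_three_nonisolated_nondet` of res-L1-w45b-lead-2's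
skeleton v10 / child v7; res-L1-w45b-plan-1 PLANNER-MEMO-g10-1 (8c1dc94511ba433d) object O1 «RatLift», PROJ / TRACE HALF (the ring half
T-RATLIFT-ALG (P1)(P2) is res-type-032's). OURS; NOT a statement of any manuscript; AI-written, weaker than expert review. No definition,
no `sorry`, standard axioms. `--supports stmt-ResolutionOfSingularities-20148 --as helper`; closes nothing by itself.

WHAT. The nose rungs of the EL♮ skeleton are instances of lead-2's class-independent closer `elnat_noseThenPoints_of_liftableCentre`
(p525611), whose only upstairs input is the clause hLIFT «for every complete DVR `O ↠ k` there is an ideal sheaf `C` on `ℙⁿ_O` with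
`V(C) → Spec O` SMOOTH and `C · 𝒪_{ℙⁿ_k} = 𝓘_Z`». This file proves hLIFT's body for ONE `O` from purely ALGEBRAIC data — a
**saturated homogeneous lift** — with no reference to the class of `Z` (complete intersection, determinantal, rational, …):

* DOWNSTAIRS: `Z ⊆ ℙⁿ_k` closed with `V(𝓘_Z)` a REGULAR scheme (`k` perfect), and a homogeneous ideal `𝔭 ≤ k[x₀..xₙ]` which is
  RADICAL with zero set `Z` (`y ∈ Z ↔ 𝔭 ≤ 𝔮_y`);
* UPSTAIRS (`O` a DVR, `π : O ↠ k`, uniformiser `ϖ`, `π ϖ = 0`): finitely many forms `G̃_l ∈ O[x]_{D_l}` spanning an ideal `𝔓` which is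
  `ϖ`-SATURATED (`C ϖ · y ∈ 𝔓 ⇒ y ∈ 𝔓`) and REDUCES TO `𝔭` UP TO SATURATION: `𝔓.map π ≤ 𝔭` and `x_i^{m₀} · 𝔭 ≤ 𝔓.map π` for all `i`.

THEN `C := 𝔓~ = projIdealSheaf O[x] ⟨span G̃, _⟩` satisfies: `V(C) → Spec O` is SMOOTH and `C.comap (Proj.map φ hφ') = vanishingIdeal ⟨Z, hZ⟩`
for every graded `φ` over `π` (`liftableCentre_of_saturatedLift`). Route: `C · 𝒪_{ℙⁿ_k} = (π G̃)~` (res-D-pv-027's base change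
`CILift.comap_projIdealSheaf_span`) `= 𝔭~` (saturation-invariance of `projIdealSheaf`, chartwise on `D₊(x_i)`) `= 𝓘_Z` (`𝔭` radical ⇒
`𝔭~` has radical sections ⇒ `𝔭~ = 𝓘_{supp 𝔭~}`, Mathlib `vanishingIdeal_support`); `V(C) → Spec O` is FLAT (stalkwise `ϖ`-regularity,
res-D-pv-027's `CILift.flat_subschemeι_comp_of_forall_stalk`, from the `ϖ`-saturation of `𝔓` transported to `(O[x]_{x_i})₀` and to the
stalks; the germ of `ϖ` on a chart is `awayToSection (ϖ/1)` by `ProjFrac.map_appTop_toSpec_eq_awayToSection_algebraMap`), hence an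
embedded `O`-lift (`EmbeddedLift.LiftsEmbedded`, res-type-027) of the REGULAR, hence SMOOTH (`smooth_of_isRegular_of_perfectField`),
`k`-scheme `V(𝓘_Z)`, so `EmbeddedLift.LiftsEmbedded.smooth` (Stacks 01V8 spread over the local base) gives smoothness.

USE. RatLift (PLANNER-MEMO-g10-1 C3a): `𝔭 = ker (aeval f)` for base-point-free forms `f` parametrising a smooth rational curve, `𝔓 = ker
(aeval F)` for a lift `F` (res-type-032 T-RATLIFT-ALG supplies (P1) saturation and (P2) reduction); any later class producing a saturated
lift (non-special curves, stage versions) plugs into the same theorem.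

References: R. Hartshorne, *Algebraic Geometry* (1977), II Prop. 5.9, Cor. 5.16, III Prop. 9.7 [Hartshorne1977]; H. Matsumura,
*Commutative Ring Theory* (1986), §30 [Matsumura1987]; Stacks 01V8 [StacksProject]; cell: PLANNER-MEMO-g10-1, LEAD-MEMO-6 (index only, OURS).
-/

set_option linter.dupNamespace false -- mandated namespace `Summit.<Summit>.<Problem>` of this single-conjunct summit
set_option linter.overlappingInstances false -- signatures carry `[IsDomain O] [IsDiscreteValuationRing O]`

noncomputable section

open CategoryTheory AlgebraicGeometry TopologicalSpace IsLocalRing Opposite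
open MvPolynomial HomogeneousLocalization
open Literature.AlgebraicGeometry.Resolution Literature.RingTheory.GradedAlgebra
open Summit.ResolutionOfSingularities.ResolutionOfSingularities.Cruxes.EquisingularLift.StrataSplit

attribute [local instance] MvPolynomial.gradedAlgebra
attribute [local instance] Literature.AlgebraicGeometry.Motives.ProjBaseChange.algebraBase

namespace Summit.ResolutionOfSingularities.ResolutionOfSingularities.Cruxes.EquisingularLiftNat.Sections

namespace SatLift

universe u

/-! ## §1 Degree-zero parts `I_{(s)}`: membership, saturation, radicals -/

section Away

variable {R A : Type u} [CommRing R] [CommRing A] [Algebra R A] (𝒜 : ℕ → Submodule R A) [GradedAlgebra 𝒜]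
  {s : A} {d : ℕ} (hs : s ∈ 𝒜 d)

/-- **Membership in `I_{(s)}`**: `a/sⁿ ∈ I_{(s)}` iff `sᵐ a ∈ I` for some `m` (through `I_{(s)} = ker ((A_s)₀ → ((A/I)_{s̄})₀)`,
tree `ker_awayMap_eq` for the graded quotient map). [cite: Hartshorne1977, II Prop. 5.11 (b) (proof)] -/
theorem mk_mem_awayIdeal_iff (I : HomogeneousIdeal 𝒜) {n : ℕ} {a : A} (ha : a ∈ 𝒜 (n • d)) :
    Away.mk 𝒜 hs n a ha ∈ awayIdeal 𝒜 hs I.toIdeal ↔ ∃ m : ℕ, s ^ m * a ∈ I := by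
  have hker := ker_awayMap_eq 𝒜 hs (quotGradedHom 𝒜 I.toIdeal)
  rw [ker_quotGradedHom] at hker
  rw [← hker, RingHom.mem_ker, Away.map_mk, Away.mk_eq_zero_iff]
  refine exists_congr fun m => ?_
  rw [← map_pow, ← map_mul, quotGradedHom_apply, Ideal.Quotient.eq_zero_iff_mem]
  rfl

/-- Powers of generating fractions: `(a/sⁿ)ᵐ = aᵐ/s^{mn}`. [folklore] -/
theorem Away.mk_pow (n m : ℕ) (a : A) (ha : a ∈ 𝒜 (n • d)) :
    Away.mk 𝒜 hs n a ha ^ m = Away.mk 𝒜 hs (m * n) (a ^ m)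
      (by rw [mul_smul]; exact SetLike.pow_mem_graded m ha) := by
  apply val_injective
  rw [val_pow, Away.val_mk, Away.val_mk, Localization.mk_pow]
  congr 1
  exact Subtype.ext (by simp only [SubmonoidClass.coe_pow]; rw [← pow_mul, mul_comm])

/-- **Saturation-invariance of `I_{(s)}`**: if `s^{m₀} · I ≤ J` then `I_{(s)} ≤ J_{(s)}`. [folklore] -/
theorem awayIdeal_le_of_forall_pow_mul_mem (I J : HomogeneousIdeal 𝒜) (m₀ : ℕ)
    (h : ∀ a ∈ I, s ^ m₀ * a ∈ J) : awayIdeal 𝒜 hs I.toIdeal ≤ awayIdeal 𝒜 hs J.toIdeal := by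
  refine Ideal.span_le.mpr ?_
  rintro _ ⟨n, a, ha, haI, rfl⟩
  exact (mk_mem_awayIdeal_iff 𝒜 hs J ha).mpr ⟨m₀, h a haI⟩

/-- **`I_{(s)}` is radical when `I` is.** [folklore] -/
theorem isRadical_awayIdeal (I : HomogeneousIdeal 𝒜) (hI : I.toIdeal.IsRadical) :
    (awayIdeal 𝒜 hs I.toIdeal).IsRadical := by
  rintro x ⟨m, hm⟩
  obtain ⟨n, a, ha, rfl⟩ := Away.mk_surjective 𝒜 hs x
  rcases Nat.eq_zero_or_pos m with rfl | hmpos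
  · -- `x⁰ = 1 ∈ I_{(s)}`, so `I_{(s)} = ⊤`
    rw [pow_zero] at hm
    rw [Ideal.eq_top_of_isUnit_mem _ hm isUnit_one]
    exact Submodule.mem_top
  rw [Away.mk_pow 𝒜 hs n m a ha, mk_mem_awayIdeal_iff] at hm
  obtain ⟨N, hN⟩ := hm
  rw [mk_mem_awayIdeal_iff]
  refine ⟨N, hI ⟨m, ?_⟩⟩
  -- `(s^N a)^m = s^{N(m-1)} · (s^N a^m) ∈ I`
  obtain ⟨m', rfl⟩ := Nat.exists_eq_add_of_le hmpos
  have : (s ^ N * a) ^ (1 + m') = s ^ (N * m') * (s ^ N * a ^ (1 + m')) := by ring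
  rw [this]
  exact Ideal.mul_mem_left _ _ hN

end Away

/-! ## §2 `ϖ`-saturation on the charts `D₊(x_i)` of `ℙⁿ_O` -/

section Saturation

variable {O : Type} [CommRing O] {n : ℕ}

/-- `ϖ/1 · a/x_iᵐ = (C ϖ · a)/x_iᵐ` in `(O[x]_{x_i})₀`. [folklore] -/
theorem algebraMap_mul_mk (i : Fin (n + 1)) (ϖ : O) (m : ℕ) (a : MvPolynomial (Fin (n + 1)) O)
    (ha : a ∈ homogeneousSubmodule (Fin (n + 1)) O (m • 1)) :
    algebraMap O (Away (homogeneousSubmodule (Fin (n + 1)) O) (X i)) ϖ *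
        Away.mk (homogeneousSubmodule (Fin (n + 1)) O) (CILift.X_mem_one' i) m a ha =
      Away.mk (homogeneousSubmodule (Fin (n + 1)) O) (CILift.X_mem_one' i) m (C ϖ * a)
        (by rw [← smul_eq_C_mul]; exact Submodule.smul_mem _ ϖ ha) := by
  apply val_injective
  rw [val_mul, Literature.AlgebraicGeometry.Motives.ProjBaseChange.val_algebraMap, Away.val_mk, Away.val_mk,
    IsScalarTower.algebraMap_apply O (MvPolynomial (Fin (n + 1)) O) (Localization _), MvPolynomial.algebraMap_eq,
    ← Localization.mk_algebraMap, Algebra.algebraMap_self, RingHom.id_apply, Localization.mk_mul, one_mul]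

/-- **`ϖ`-saturation descends to the chart**: if `C ϖ · y ∈ 𝔓 ⇒ y ∈ 𝔓` in `O[x]`, then `ϖ/1 · z ∈ 𝔓_{(x_i)} ⇒ z ∈ 𝔓_{(x_i)}` in
`(O[x]_{x_i})₀`. [folklore] -/
theorem mem_awayIdeal_of_algebraMap_mul_mem (i : Fin (n + 1)) (𝔓 : HomogeneousIdeal (homogeneousSubmodule (Fin (n + 1)) O))
    (ϖ : O) (hsat : ∀ y, C ϖ * y ∈ 𝔓 → y ∈ 𝔓) (z : Away (homogeneousSubmodule (Fin (n + 1)) O) (X i))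
    (hz : algebraMap O _ ϖ * z ∈ awayIdeal (homogeneousSubmodule (Fin (n + 1)) O) (CILift.X_mem_one' i) 𝔓.toIdeal) :
    z ∈ awayIdeal (homogeneousSubmodule (Fin (n + 1)) O) (CILift.X_mem_one' i) 𝔓.toIdeal := by
  obtain ⟨m, a, ha, rfl⟩ := Away.mk_surjective _ (CILift.X_mem_one' i) z
  rw [algebraMap_mul_mk, mk_mem_awayIdeal_iff] at hz
  obtain ⟨N, hN⟩ := hz
  rw [mk_mem_awayIdeal_iff]
  refine ⟨N, hsat _ ?_⟩
  rw [mul_left_comm]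
  exact hN

end Saturation


/-! ## §3 On `ℙⁿ_k`: saturation-invariance of `projIdealSheaf`, and `𝔭~ = 𝓘_{V₊(𝔭)}` for radical `𝔭` -/

section Downstairs

variable {k : Type} [CommRing k] {n : ℕ}

/-- The standard charts cover `ℙⁿ`. [cite: Hartshorne1977, II Prop. 2.5 (proof)] -/
theorem iSup_chart_eq_top (k : Type) [CommRing k] (n : ℕ) :
    ⨆ i : Fin (n + 1), (((⟨Proj.basicOpen (homogeneousSubmodule (Fin (n + 1)) k) (X i), Proj.isAffineOpen_basicOpen (homogeneousSubmodule (Fin (n + 1)) k) (X i) (CILift.X_mem_one' i) one_pos⟩ : (Proj (homogeneousSubmodule (Fin (n + 1)) k)).affineOpens) : (Proj (homogeneousSubmodule (Fin (n + 1)) k)).affineOpens) :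
      (Proj (homogeneousSubmodule (Fin (n + 1)) k)).Opens) = ⊤ :=
  Proj.iSup_basicOpen_eq_top (homogeneousSubmodule (Fin (n + 1)) k)
    (fun i : Fin (n + 1) => (X i : MvPolynomial (Fin (n + 1)) k)) (irrelevant_le_span n k)

/-- Every point of `ℙⁿ` lies on some standard chart. [cite: Hartshorne1977, II Prop. 2.5 (proof)] -/
theorem exists_mem_chart (x : Proj (homogeneousSubmodule (Fin (n + 1)) k)) :
    ∃ i : Fin (n + 1), x ∈ Proj.basicOpen (homogeneousSubmodule (Fin (n + 1)) k) (X i) := by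
  have hx : x ∈ (⊤ : (Proj (homogeneousSubmodule (Fin (n + 1)) k)).Opens) := trivial
  rw [← iSup_chart_eq_top k n, Opens.mem_iSup] at hx
  exact hx

/-- `awayToSection : (k[x]_{x_i})₀ → Γ(ℙⁿ, D₊(x_i))` is bijective. [cite: Hartshorne1977, II Prop. 2.5 (b)] -/
theorem awayToSection_bijective (i : Fin (n + 1)) :
    Function.Bijective (Proj.awayToSection (homogeneousSubmodule (Fin (n + 1)) k) (X i)).hom := by
  haveI : IsIso (Proj.awayToSection (homogeneousSubmodule (Fin (n + 1)) k) (X i)) := by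
    rw [← Proj.basicOpenIsoAway_hom _ (X i) (CILift.X_mem_one' i) one_pos]
    infer_instance
  exact ConcreteCategory.bijective_of_isIso (Proj.awayToSection (homogeneousSubmodule (Fin (n + 1)) k) (X i))

/-- **Sections of `Ĩ` over `D₊(x_i)`** (tree `projIdealSheaf_ideal_basicOpen`, restated for the named chart). [cite: Hartshorne1977, II Prop. 5.9] -/
theorem ideal_chart (I : HomogeneousIdeal (homogeneousSubmodule (Fin (n + 1)) k)) (i : Fin (n + 1)) :
    (projIdealSheaf (homogeneousSubmodule (Fin (n + 1)) k) I).ideal (⟨Proj.basicOpen (homogeneousSubmodule (Fin (n + 1)) k) (X i), Proj.isAffineOpen_basicOpen (homogeneousSubmodule (Fin (n + 1)) k) (X i) (CILift.X_mem_one' i) one_pos⟩ : (Proj (homogeneousSubmodule (Fin (n + 1)) k)).affineOpens) =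
      (awayIdeal (homogeneousSubmodule (Fin (n + 1)) k) (CILift.X_mem_one' i) I.toIdeal).map
        (Proj.awayToSection (homogeneousSubmodule (Fin (n + 1)) k) (X i)).hom :=
  projIdealSheaf_ideal_basicOpen _ I one_pos (CILift.X_mem_one' i)

/-- **Saturation-invariance of `projIdealSheaf`**: homogeneous ideals `J ≤ I` with `x_i^{m₀} · I ≤ J` for every `i` have the same
ideal sheaf on `ℙⁿ` (they agree on every chart `D₊(x_i)`). [cite: Hartshorne1977, II Ex. 5.10] -/
theorem projIdealSheaf_eq_of_saturation (J I : HomogeneousIdeal (homogeneousSubmodule (Fin (n + 1)) k)) (hJI : J ≤ I) (m₀ : ℕ)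
    (hsat : ∀ (i : Fin (n + 1)), ∀ a ∈ I, (X i) ^ m₀ * a ∈ J) :
    projIdealSheaf (homogeneousSubmodule (Fin (n + 1)) k) J = projIdealSheaf (homogeneousSubmodule (Fin (n + 1)) k) I := by
  refine Scheme.IdealSheafData.ext_of_iSup_eq_top (fun i : Fin (n + 1) => (⟨Proj.basicOpen (homogeneousSubmodule (Fin (n + 1)) k) (X i), Proj.isAffineOpen_basicOpen (homogeneousSubmodule (Fin (n + 1)) k) (X i) (CILift.X_mem_one' i) one_pos⟩ : (Proj (homogeneousSubmodule (Fin (n + 1)) k)).affineOpens)) (iSup_chart_eq_top k n) fun i => ?_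
  rw [ideal_chart, ideal_chart]
  exact le_antisymm (Ideal.map_mono (awayIdeal_mono _ _ hJI))
    (Ideal.map_mono (awayIdeal_le_of_forall_pow_mul_mem _ _ I J m₀ (hsat i)))

/-- **`𝔭~` is a radical ideal sheaf for `𝔭` radical** (its sections over the charts are the radical ideals `𝔭_{(x_i)}`).
[cite: Hartshorne1977, II Cor. 5.16] -/
theorem radical_projIdealSheaf_eq (I : HomogeneousIdeal (homogeneousSubmodule (Fin (n + 1)) k)) (hI : I.toIdeal.IsRadical) :
    (projIdealSheaf (homogeneousSubmodule (Fin (n + 1)) k) I).radical = projIdealSheaf (homogeneousSubmodule (Fin (n + 1)) k) I := by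
  refine Scheme.IdealSheafData.ext_of_iSup_eq_top (fun i : Fin (n + 1) => (⟨Proj.basicOpen (homogeneousSubmodule (Fin (n + 1)) k) (X i), Proj.isAffineOpen_basicOpen (homogeneousSubmodule (Fin (n + 1)) k) (X i) (CILift.X_mem_one' i) one_pos⟩ : (Proj (homogeneousSubmodule (Fin (n + 1)) k)).affineOpens)) (iSup_chart_eq_top k n) fun i => ?_
  rw [Scheme.IdealSheafData.radical_ideal, ideal_chart]
  have hker : RingHom.ker (Proj.awayToSection (homogeneousSubmodule (Fin (n + 1)) k) (X i)).hom ≤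
      awayIdeal (homogeneousSubmodule (Fin (n + 1)) k) (CILift.X_mem_one' i) I.toIdeal := by
    rw [(RingHom.injective_iff_ker_eq_bot _).mp (awayToSection_bijective i).1]; exact bot_le
  have h := Ideal.map_radical_of_surjective (awayToSection_bijective (k := k) i).2 hker
  rw [(isRadical_awayIdeal _ _ I hI).radical] at h
  exact h.symm

/-- **`𝔭~ = 𝓘_{V₊(𝔭)}` for a radical homogeneous ideal `𝔭`**: with `Z = {y | 𝔭 ≤ 𝔮_y}` closed, `projIdealSheaf k[x] 𝔭 = vanishingIdeal Z`
(Mathlib `vanishingIdeal_support : 𝓘_{supp I} = √I`, the support being `V₊(𝔭)` by res-D-pv-027's `CILift.support_projIdealSheaf_eq`).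
[cite: Hartshorne1977, II Cor. 5.16] -/
theorem projIdealSheaf_eq_vanishingIdeal (I : HomogeneousIdeal (homogeneousSubmodule (Fin (n + 1)) k)) (hI : I.toIdeal.IsRadical)
    (Z : Set (Proj (homogeneousSubmodule (Fin (n + 1)) k))) (hZ : IsClosed Z)
    (hZI : Z = {y | I.toIdeal ≤ y.asHomogeneousIdeal.toIdeal}) :
    projIdealSheaf (homogeneousSubmodule (Fin (n + 1)) k) I = Scheme.IdealSheafData.vanishingIdeal ⟨Z, hZ⟩ := by
  have hsupp : (projIdealSheaf (homogeneousSubmodule (Fin (n + 1)) k) I).support = ⟨Z, hZ⟩ :=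
    Closeds.ext ((CILift.support_projIdealSheaf_eq _ I).trans hZI.symm)
  rw [← hsupp, Scheme.IdealSheafData.vanishingIdeal_support, radical_projIdealSheaf_eq I hI]

/-- **The downstairs trace**: for forms `G_l` of degrees `D_l` spanning `J ≤ 𝔭` with `x_i^{m₀} · 𝔭 ≤ J` for all `i`, `𝔭` radical with
zero set `Z`: `(G)~ = 𝓘_Z`. [cite: Hartshorne1977, II Cor. 5.16 and Ex. 5.10] -/
theorem projIdealSheaf_span_eq_vanishingIdeal {ι' : Type} (G : ι' → MvPolynomial (Fin (n + 1)) k) (D : ι' → ℕ)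
    (hG : ∀ l, G l ∈ homogeneousSubmodule (Fin (n + 1)) k (D l))
    (𝔭 : HomogeneousIdeal (homogeneousSubmodule (Fin (n + 1)) k)) (h𝔭 : 𝔭.toIdeal.IsRadical)
    (hle : ∀ l, G l ∈ 𝔭) (m₀ : ℕ) (hsat : ∀ (i : Fin (n + 1)), ∀ a ∈ 𝔭, (X i) ^ m₀ * a ∈ Ideal.span (Set.range G))
    (Z : Set (Proj (homogeneousSubmodule (Fin (n + 1)) k))) (hZ : IsClosed Z)
    (hZ𝔭 : Z = {y | 𝔭.toIdeal ≤ y.asHomogeneousIdeal.toIdeal}) :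
    projIdealSheaf (homogeneousSubmodule (Fin (n + 1)) k)
        ⟨Ideal.span (Set.range G), isHomogeneous_span_of_forall_mem _ G D hG⟩ =
      Scheme.IdealSheafData.vanishingIdeal ⟨Z, hZ⟩ := by
  rw [← projIdealSheaf_eq_vanishingIdeal 𝔭 h𝔭 Z hZ hZ𝔭]
  refine projIdealSheaf_eq_of_saturation _ 𝔭 ?_ m₀ hsat
  change Ideal.span (Set.range G) ≤ 𝔭.toIdeal
  rw [Ideal.span_le, Set.range_subset_iff]
  exact hle

end Downstairs

/-! ## §4 On `ℙⁿ_O`: a `ϖ`-saturated `𝔓~` has `O`-flat `V(𝔓~)` -/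

section Flat

variable (O : Type) [CommRing O] [IsDomain O] [IsDiscreteValuationRing O] {n : ℕ}

/-- **`V(𝔓~) → Spec O` is FLAT for a `ϖ`-saturated ideal `𝔓 = (G̃_l)` of forms** (`O` a DVR with uniformiser `ϖ`). Stalkwise
`ϖ`-regularity modulo `𝔓~_x` (res-D-pv-027's `CILift.flat_subschemeι_comp_of_forall_stalk`, Hartshorne III 9.7): on a chart
`D₊(x_i) ∋ x`, `𝔓~_x` is the extension of `𝔓_{(x_i)} ⊆ (O[x]_{x_i})₀ ≅ Γ(D₊(x_i))` to the local ring `𝒪_x` (a localisation), `𝔓_{(x_i)}`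
is `ϖ`-saturated (§2) and so is its extension (`mem_map_of_mul_mem_localization`); the germ of `ϖ` is that of `awayToSection (ϖ/1)`
(`ProjFrac.map_appTop_toSpec_eq_awayToSection_algebraMap`). [cite: Hartshorne1977, III Prop. 9.7] -/
theorem flat_subschemeι_projIdealSheaf_of_saturated (ϖ : O) (hϖ : Irreducible ϖ) {c : ℕ}
    (Gt : Fin c → MvPolynomial (Fin (n + 1)) O) (D : Fin c → ℕ) (hGt : ∀ l, Gt l ∈ homogeneousSubmodule (Fin (n + 1)) O (D l))
    (hsat : ∀ y, C ϖ * y ∈ Ideal.span (Set.range Gt) → y ∈ Ideal.span (Set.range Gt)) :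
    Flat ((projIdealSheaf (homogeneousSubmodule (Fin (n + 1)) O)
        ⟨Ideal.span (Set.range Gt), isHomogeneous_span_of_forall_mem _ Gt D hGt⟩).subschemeι ≫
      (Proj.toSpecZero (homogeneousSubmodule (Fin (n + 1)) O) ≫
        Spec.map (CommRingCat.ofHom (algebraMap O ((homogeneousSubmodule (Fin (n + 1)) O) 0))))) := by
  refine CILift.flat_subschemeι_comp_of_forall_stalk O _ _ ϖ hϖ fun x hxC _ a ha => ?_
  -- a chart `D₊(x_i) ∋ x`; the stalk is a localisation of `Γ(D₊(x_i))`
  obtain ⟨i, hxi⟩ := exists_mem_chart (k := O) x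
  letI : Algebra Γ(Proj (homogeneousSubmodule (Fin (n + 1)) O), Proj.basicOpen (homogeneousSubmodule (Fin (n + 1)) O) (X i))
      ((Proj (homogeneousSubmodule (Fin (n + 1)) O)).presheaf.stalk x) :=
    TopCat.Presheaf.algebra_section_stalk (Proj (homogeneousSubmodule (Fin (n + 1)) O)).presheaf
      (U := Proj.basicOpen (homogeneousSubmodule (Fin (n + 1)) O) (X i)) ⟨x, hxi⟩
  haveI : IsLocalization.AtPrime ((Proj (homogeneousSubmodule (Fin (n + 1)) O)).presheaf.stalk x)
      ((Proj.isAffineOpen_basicOpen (homogeneousSubmodule (Fin (n + 1)) O) (X i) (CILift.X_mem_one' i) one_pos).primeIdealOf ⟨x, hxi⟩).asIdeal :=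
    (Proj.isAffineOpen_basicOpen (homogeneousSubmodule (Fin (n + 1)) O) (X i) (CILift.X_mem_one' i) one_pos).isLocalization_stalk ⟨x, hxi⟩
  -- `𝔓~_x` is the extension of the chart ideal `𝔞 = awayToSection (𝔓_{(x_i)})`
  have hst : stalkIdeal (projIdealSheaf (homogeneousSubmodule (Fin (n + 1)) O)
        ⟨Ideal.span (Set.range Gt), isHomogeneous_span_of_forall_mem _ Gt D hGt⟩) x =
      ((awayIdeal (homogeneousSubmodule (Fin (n + 1)) O) (CILift.X_mem_one' i) (Ideal.span (Set.range Gt))).map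
          (Proj.awayToSection (homogeneousSubmodule (Fin (n + 1)) O) (X i)).hom).map
        (algebraMap Γ(Proj (homogeneousSubmodule (Fin (n + 1)) O), Proj.basicOpen (homogeneousSubmodule (Fin (n + 1)) O) (X i))
          ((Proj (homogeneousSubmodule (Fin (n + 1)) O)).presheaf.stalk x)) := by
    rw [stalkIdeal_eq_map_germ _ (⟨Proj.basicOpen (homogeneousSubmodule (Fin (n + 1)) O) (X i), Proj.isAffineOpen_basicOpen (homogeneousSubmodule (Fin (n + 1)) O) (X i) (CILift.X_mem_one' i) one_pos⟩ : (Proj (homogeneousSubmodule (Fin (n + 1)) O)).affineOpens) hxi, ideal_chart]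
    rfl
  -- the chart ideal is saturated with respect to `b = awayToSection (ϖ/1)` (transport of §2 along the iso `awayToSection`)
  have hbij := awayToSection_bijective (k := O) (n := n) i
  have h𝔞sat : ∀ y : Γ(Proj (homogeneousSubmodule (Fin (n + 1)) O), Proj.basicOpen (homogeneousSubmodule (Fin (n + 1)) O) (X i)),
      (Proj.awayToSection (homogeneousSubmodule (Fin (n + 1)) O) (X i)).hom
          (algebraMap O (Away (homogeneousSubmodule (Fin (n + 1)) O) (X i)) ϖ) * y ∈
        (awayIdeal (homogeneousSubmodule (Fin (n + 1)) O) (CILift.X_mem_one' i) (Ideal.span (Set.range Gt))).map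
          (Proj.awayToSection (homogeneousSubmodule (Fin (n + 1)) O) (X i)).hom →
      y ∈ (awayIdeal (homogeneousSubmodule (Fin (n + 1)) O) (CILift.X_mem_one' i) (Ideal.span (Set.range Gt))).map
          (Proj.awayToSection (homogeneousSubmodule (Fin (n + 1)) O) (X i)).hom := by
    intro y hy
    obtain ⟨z, rfl⟩ := hbij.2 y
    rw [← map_mul] at hy
    obtain ⟨w, hw, hwz⟩ := (Ideal.mem_map_iff_of_surjective _ hbij.2).mp hy
    have hzmem : algebraMap O (Away (homogeneousSubmodule (Fin (n + 1)) O) (X i)) ϖ * z ∈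
        awayIdeal (homogeneousSubmodule (Fin (n + 1)) O) (CILift.X_mem_one' i) (Ideal.span (Set.range Gt)) := by
      rw [← hbij.1 hwz]; exact hw
    exact Ideal.mem_map_of_mem _ (mem_awayIdeal_of_algebraMap_mul_mem i
      ⟨Ideal.span (Set.range Gt), isHomogeneous_span_of_forall_mem _ Gt D hGt⟩ ϖ hsat z hzmem)
  -- the germ of `ϖ` at `x` is the germ of `b`
  have h1 := Literature.AlgebraicGeometry.Motives.ProjFrac.map_appTop_toSpec_eq_awayToSection_algebraMap (A := O) (r := n)
    (CILift.X_mem_one' i) one_pos ϖ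
  have hgermb : ((Proj (homogeneousSubmodule (Fin (n + 1)) O)).presheaf.Γgerm x).hom
      ((Proj.toSpecZero (homogeneousSubmodule (Fin (n + 1)) O) ≫
          Spec.map (CommRingCat.ofHom (algebraMap O ((homogeneousSubmodule (Fin (n + 1)) O) 0)))).appTop.hom
        ((Scheme.ΓSpecIso (.of O)).inv.hom ϖ)) =
      algebraMap Γ(Proj (homogeneousSubmodule (Fin (n + 1)) O), Proj.basicOpen (homogeneousSubmodule (Fin (n + 1)) O) (X i))
        ((Proj (homogeneousSubmodule (Fin (n + 1)) O)).presheaf.stalk x)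
        ((Proj.awayToSection (homogeneousSubmodule (Fin (n + 1)) O) (X i)).hom
          (algebraMap O (Away (homogeneousSubmodule (Fin (n + 1)) O) (X i)) ϖ)) := by
    change _ = ((Proj (homogeneousSubmodule (Fin (n + 1)) O)).presheaf.germ _ x hxi).hom _
    erw [← h1]
    exact (TopCat.Presheaf.germ_res_apply (Proj (homogeneousSubmodule (Fin (n + 1)) O)).presheaf (homOfLE le_top) x hxi _).symm
  -- transport the saturation to the stalk
  rw [hst, hgermb] at ha
  rw [hst]
  exact mem_map_of_mul_mem_localization
    ((Proj.isAffineOpen_basicOpen (homogeneousSubmodule (Fin (n + 1)) O) (X i) (CILift.X_mem_one' i) one_pos).primeIdealOf ⟨x, hxi⟩).asIdeal.primeCompl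
    ((Proj (homogeneousSubmodule (Fin (n + 1)) O)).presheaf.stalk x) h𝔞sat a ha

end Flat

/-! ## §5 The capstone: a saturated lift of a radical ideal with regular zero set is a liftable centre -/

section Capstone

variable {O : Type} [CommRing O] [IsDomain O] [IsDiscreteValuationRing O] {k : Type} [Field k] [PerfectField k]
  (π : O →+* k) (hπ : Function.Surjective π) (ϖ : O) (hϖ : Irreducible ϖ) {n : ℕ}

include hπ hϖ in
/-- **SATURATED LIFT ⇒ LIFTABLE CENTRE.** `O` a DVR with uniformiser `ϖ` (any irreducible element), `π : O ↠ k` onto a PERFECT field.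
DOWNSTAIRS: `Z ⊆ ℙⁿ_k` closed with `V(𝓘_Z)` REGULAR; a RADICAL homogeneous `𝔭 ≤ k[x]` with zero set `Z` (`y ∈ Z ↔ 𝔭 ≤ 𝔮_y`).
UPSTAIRS: forms `G̃_l ∈ O[x]_{D_l}` spanning a `ϖ`-SATURATED ideal `𝔓` (`C ϖ · y ∈ 𝔓 ⇒ y ∈ 𝔓`) with `π(G̃_l) ∈ 𝔭` and
`x_i^{m₀} · 𝔭 ≤ (π G̃)` for all `i`. THEN `C := 𝔓~` has `V(C) → Spec O` SMOOTH and `C · 𝒪_{ℙⁿ_k} = 𝓘_Z` along every graded `φ` over `π` —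
the body of the hLIFT clause of lead-2's `elnat_noseThenPoints_of_liftableCentre` (p525611) for this `O`. Assembly: §3 (trace), §4 (flat),
res-type-027's `EmbeddedLift.LiftsEmbedded.smooth` with the regular-hence-smooth special fibre (`smooth_of_isRegular_of_perfectField`).
[cite: Hartshorne1977, III Prop. 9.7; Matsumura1987, §30 Lemma 1; StacksProject, Tag 01V8] -/
theorem liftableCentre_of_saturatedLift {c : ℕ}
    (Gt : Fin c → MvPolynomial (Fin (n + 1)) O) (D : Fin c → ℕ) (hGt : ∀ l, Gt l ∈ homogeneousSubmodule (Fin (n + 1)) O (D l))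
    (hsat : ∀ y, C ϖ * y ∈ Ideal.span (Set.range Gt) → y ∈ Ideal.span (Set.range Gt))
    (𝔭 : HomogeneousIdeal (homogeneousSubmodule (Fin (n + 1)) k)) (h𝔭 : 𝔭.toIdeal.IsRadical)
    (hle : ∀ l, MvPolynomial.map π (Gt l) ∈ 𝔭) (m₀ : ℕ)
    (hred : ∀ (i : Fin (n + 1)), ∀ a ∈ 𝔭, (X i) ^ m₀ * a ∈ Ideal.span (Set.range fun l => MvPolynomial.map π (Gt l)))
    (Z : Set (Proj (homogeneousSubmodule (Fin (n + 1)) k))) (hZ : IsClosed Z)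
    (hZ𝔭 : Z = {y | 𝔭.toIdeal ≤ y.asHomogeneousIdeal.toIdeal})
    (hZreg : Scheme.IsRegular (Scheme.IdealSheafData.vanishingIdeal ⟨Z, hZ⟩).subscheme) :
    Smooth ((projIdealSheaf (homogeneousSubmodule (Fin (n + 1)) O)
        ⟨Ideal.span (Set.range Gt), isHomogeneous_span_of_forall_mem _ Gt D hGt⟩).subschemeι ≫
      (Proj.toSpecZero (homogeneousSubmodule (Fin (n + 1)) O) ≫
        Spec.map (CommRingCat.ofHom (algebraMap O ((homogeneousSubmodule (Fin (n + 1)) O) 0))))) ∧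
    ∀ (φ : (homogeneousSubmodule (Fin (n + 1)) O) →+*ᵍ (homogeneousSubmodule (Fin (n + 1)) k))
      (hφ' : HomogeneousIdeal.irrelevant (homogeneousSubmodule (Fin (n + 1)) k) ≤
        (HomogeneousIdeal.irrelevant (homogeneousSubmodule (Fin (n + 1)) O)).map φ),
      (∀ s, φ s = MvPolynomial.map π s) →
      (projIdealSheaf (homogeneousSubmodule (Fin (n + 1)) O)
          ⟨Ideal.span (Set.range Gt), isHomogeneous_span_of_forall_mem _ Gt D hGt⟩).comap (Proj.map φ hφ') =
        Scheme.IdealSheafData.vanishingIdeal ⟨Z, hZ⟩ := by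
  -- the downstairs forms `G = π G̃`
  set G : Fin c → MvPolynomial (Fin (n + 1)) k := fun l => MvPolynomial.map π (Gt l) with hGdef
  have hG : ∀ l, G l ∈ homogeneousSubmodule (Fin (n + 1)) k (D l) := fun l =>
    (mem_homogeneousSubmodule _ _).mpr (((mem_homogeneousSubmodule _ _).mp (hGt l)).map π)
  -- TRACE along any `φ` over `π`
  have htrace : ∀ (φ : (homogeneousSubmodule (Fin (n + 1)) O) →+*ᵍ (homogeneousSubmodule (Fin (n + 1)) k))
      (hφ' : HomogeneousIdeal.irrelevant (homogeneousSubmodule (Fin (n + 1)) k) ≤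
        (HomogeneousIdeal.irrelevant (homogeneousSubmodule (Fin (n + 1)) O)).map φ),
      (∀ s, φ s = MvPolynomial.map π s) →
      (projIdealSheaf (homogeneousSubmodule (Fin (n + 1)) O)
          ⟨Ideal.span (Set.range Gt), isHomogeneous_span_of_forall_mem _ Gt D hGt⟩).comap (Proj.map φ hφ') =
        Scheme.IdealSheafData.vanishingIdeal ⟨Z, hZ⟩ := by
    intro φ hφ' hφ
    have hφX : ∀ i : Fin (n + 1), φ (X i) = X i := fun i => by rw [hφ, map_X]
    have hφG : ∀ l, φ (Gt l) = G l := fun l => by rw [hφ]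
    rw [CILift.comap_projIdealSheaf_span φ hφ' hφX Gt G D hGt hG hφG]
    exact projIdealSheaf_span_eq_vanishingIdeal G D hG 𝔭 h𝔭 hle m₀ hred Z hZ hZ𝔭
  refine ⟨?_, htrace⟩
  -- SMOOTH: embedded lift of the regular (hence smooth) `V(𝓘_Z)`
  let φ₀ : (homogeneousSubmodule (Fin (n + 1)) O) →+*ᵍ (homogeneousSubmodule (Fin (n + 1)) k) :=
    ⟨MvPolynomial.map π, fun h => h.map π⟩
  have hφ₀ : ∀ s, φ₀ s = MvPolynomial.map π s := fun _ => rfl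
  have hφ₀' := ProjectiveAmbientFibre.irrelevant_le_map_gradedMap π φ₀ hφ₀
  have hflat := flat_subschemeι_projIdealSheaf_of_saturated O ϖ hϖ Gt D hGt hsat
  have h : EmbeddedLift.LiftsEmbedded φ₀ hφ₀' (Scheme.IdealSheafData.vanishingIdeal ⟨Z, hZ⟩).subschemeι
      (projIdealSheaf (homogeneousSubmodule (Fin (n + 1)) O)
        ⟨Ideal.span (Set.range Gt), isHomogeneous_span_of_forall_mem _ Gt D hGt⟩) := by
    refine ⟨hflat, ?_⟩
    rw [htrace φ₀ hφ₀' hφ₀, Scheme.IdealSheafData.ker_subschemeι]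
  -- the special fibre `V(𝓘_Z) → Spec k` is smooth: regular of finite type over a perfect field
  obtain ⟨hsm, -⟩ := stub_projectiveAmbientSmoothProper k n
  haveI := hsm
  haveI : LocallyOfFiniteType ((Scheme.IdealSheafData.vanishingIdeal ⟨Z, hZ⟩).subschemeι ≫
      (Proj.toSpecZero (homogeneousSubmodule (Fin (n + 1)) k) ≫
        Spec.map (CommRingCat.ofHom (algebraMap k ((homogeneousSubmodule (Fin (n + 1)) k) 0))))) := inferInstance
  have hS := smooth_of_isRegular_of_perfectField ((Scheme.IdealSheafData.vanishingIdeal ⟨Z, hZ⟩).subschemeι ≫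
      (Proj.toSpecZero (homogeneousSubmodule (Fin (n + 1)) k) ≫
        Spec.map (CommRingCat.ofHom (algebraMap k ((homogeneousSubmodule (Fin (n + 1)) k) 0))))) hZreg
  exact EmbeddedLift.LiftsEmbedded.smooth π hπ hφ₀ h hS

end Capstone

end SatLift

end Summit.ResolutionOfSingularities.ResolutionOfSingularities.Cruxes.EquisingularLiftNat.Sections

end
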